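import Literature.NumberTheory.EllipticCurves.Rank1Residual.GVParityIsogenyConjugationProofs
import Literature.NumberTheory.EllipticCurves.Rank1Residual.Predicates
import Literature.NumberTheory.EllipticCurves.SerreOpenImageOrdinaryInertiaProofs
import HarnessLib

/-!
# Serre's ordinary line (hL) at a good ordinary prime of `E/ℚ`, in `𝔓.inertia` form; the
# Greenberg–Vatsal parity type is an isogeny invariant on class X1 — unconditionally

HONEST FRAMING (cell `b2b-bsdres`, home `run/shared/lean/b2b/bsd-rank1-residual/`): the cell deletes
COMBINATION-SHAPED residual classes of the rank-`≤ 1` BSD formula from PUBLISHED theorems only and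
types the rest; this is not "finishing BSD". `Proofs`-style file (theorems only, no definition, no
named fact), prover x1a gen 3, sequel of `GVParityIsogenyProofs.lean` /
`GVParityIsogenyConjugationProofs.lean` (gen 2). It settles the one kernel debt left on class X1 by
the cell's referee (REFEREE R16.3): the hypothesis (hL) of `gvPar_iff_of_isogeny_of_ordinaryLine` —
Serre's ordinary line at every prime `𝔓` of `\bar ℤ` above `p`, in the `𝔓.inertia Γ_ℚ`
vocabulary of `Rank1Residual/Predicates.lean` — is a THEOREM of the tree at every good ordinary
prime `p` of a globally minimal `E/ℚ`, `p` odd: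

* (hL) `exists_ordinaryLine_of_not_dvd_frobeniusTrace`: for `v ∣ p` and `𝔓 ∈ v.primesAbove` there
  is `L ≤ E[p]` of order `p` with `σ • P - P ∈ L` for all `σ ∈ I_𝔓`, `P ∈ E[p]`, and some
  `σ ∈ I_𝔓` moving a point of `L`. The line and the inclusion `(σ - 1) E[p] ⊆ L` are Serre 1972,
  §1.11, Prop. 11 and Cor. in the frame-free `𝔓`-form already assembled in the tree for Serre's
  open image theorem (`exists_line_of_not_dvd_frobeniusTrace_of_mem_primesAbove`,
  `SerreOpenImageOrdinaryInertiaProofs`: reduction map invariant under `I_𝔓`, non-zero on `E[p]`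
  at an ordinary prime, counting); that `I_𝔓` MOVES the line is Serre's "`χ_X χ_Y = det`": `I_𝔓`
  acts on `L` through `det ρ̄ = χ̄_p` (Weil pairing) and `χ̄_p(I_𝔓) = 𝔽_pˣ ∋ -1 ≠ 1` for `p` odd
  (`exists_mem_inertia_smul_eq_of_sub_mem_line`, `SerreOpenImageOfLocalInputProofs`;
  `ℚ(ζ_p)/ℚ` totally ramified at `p`).
* `gvPar_of_isogeny_of_not_dvd_frobeniusTrace`, `gvPar_iff_of_isogeny_of_not_dvd_frobeniusTrace`:
  transfer / invariance of `GVPar` along `ℚ`-isogenies not killing `E[p]` at a good ordinary odd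
  `p`, NO residual hypothesis ((hc) was discharged in `GVParityIsogenyConjugationProofs`).
* `exists_ordinaryLine_of_anom`, `gvPar_iff_of_isogeny_of_anom`: the case of class X1 (an
  anomalous Eisenstein prime of good reduction is ordinary, `goodOrd_of_anom`): **the parity type
  A / B of the census `b2b-bsdres-x1a/X1-CENSUS-g2.md` is a property of the `ℚ`-isogeny class**
  (for isogenies not killing `E[p]`, e.g. every cyclic isogeny and its dual), as was verified
  numerically on all 1524 census classes.

## References
* J.-P. Serre, Invent. Math. 15 (1972), §1.11, Prop. 11 and Cor. [SerreInventiones1972]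
* R. Greenberg, V. Vatsal, Invent. Math. 142 (2000), Thm. (1.3). [GreenbergVatsal2000]
* J. H. Silverman, *AEC*, III.8.1 (Weil pairing), VII.3.1. [SilvermanAEC2009]
-/

set_option autoImplicit false

noncomputable section

open scoped Classical

open WeierstrassCurve Literature.NumberTheory.EllipticCurves Literature.NumberTheory.GaloisRepresentations
  Field IsDedekindDomain NumberField

namespace Literature.NumberTheory.EllipticCurves.Rank1Residual

variable {W W' : WeierstrassCurve ℚ} [W.IsElliptic] [W'.IsElliptic] {p : ℕ} [Fact p.Prime]

/-! ### (hL): Serre's ordinary line in `𝔓.inertia` form -/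

variable (W) in
/-- **Serre's ordinary line (hL), `𝔓`-form.** Let `E/ℚ` be given by a globally minimal `W`, `p` an
odd prime of good ORDINARY reduction (`p ∤ a_p`), `v` the place of `ℚ` at `p` and `𝔓` any prime of
`\bar ℤ` above `v`. Then there is a subgroup `L ≤ E[p]` of order `p` such that every `σ` of the
inertia group `I_𝔓 ≤ Γ_ℚ` acts trivially on `E[p]/L` (`σ • P - P ∈ L`) and some `σ ∈ I_𝔓` moves a
point of `L` (indeed `I_𝔓 → Aut L = 𝔽_pˣ` is `χ̄_p`, onto). Serre 1972, §1.11, Prop. 11 ("la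
droite `X_p`") and Cor. ("l'image de `I_p` … est contenue dans un sous-groupe de Borel … `(χ *; 0 1)`"),
assembled from the tree's `exists_line_of_not_dvd_frobeniusTrace_of_mem_primesAbove` and
`exists_mem_inertia_smul_eq_of_sub_mem_line` (with `a = -1 ≠ 1`, `p` odd).
[cite: SerreInventiones1972, §1.11 Prop. 11 and Cor.] -/
theorem exists_ordinaryLine_of_not_dvd_frobeniusTrace [W.IsGloballyMinimal] (hp2 : p ≠ 2)
    (hgood : W.HasGoodReductionAtPrime p) (hord : ¬ (p : ℤ) ∣ W.frobeniusTrace p) :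
    ∀ (v : HeightOneSpectrum (𝓞 ℚ)), (p : 𝓞 ℚ) ∈ v.asIdeal → ∀ 𝔓 ∈ v.primesAbove,
      ∃ L : AddSubgroup (geomTorsion W (p : ℤ)), Nat.card L = p ∧
        (∀ σ ∈ 𝔓.inertia (absoluteGaloisGroup ℚ), ∀ P : geomTorsion W (p : ℤ), σ • P - P ∈ L) ∧
        (∃ σ ∈ 𝔓.inertia (absoluteGaloisGroup ℚ), ∃ P ∈ L, σ • P ≠ P) := by
  intro v hv 𝔓 h𝔓
  letI : Module (ZMod p) (geomTorsion W (p : ℤ)) := AddSubgroup.torsionBy.zmodModule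
  have hp : p.Prime := Fact.out
  have hvp : (Rat.HeightOneSpectrum.primesEquiv v : ℕ) = p := primesEquiv_eq_of_natCast_mem hp hv
  have hΔ : ¬ (p : ℤ) ∣ minimalDiscriminantInt W :=
    W.not_dvd_minimalDiscriminantInt_of_hasGoodReductionAtPrime' p hgood
  obtain ⟨v₀, hv₀, hline⟩ :=
    exists_line_of_not_dvd_frobeniusTrace_of_mem_primesAbove p hΔ hord hvp h𝔓
  -- `b • v₀ ∈ ℤ v₀` for `b : 𝔽_p`
  have hmem : ∀ b : ZMod p, b • v₀ ∈ AddSubgroup.zmultiples v₀ := fun b ↦ by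
    rw [← ZMod.natCast_zmod_val b, Nat.cast_smul_eq_nsmul]
    exact AddSubgroup.nsmul_mem _ (AddSubgroup.mem_zmultiples v₀) _
  refine ⟨AddSubgroup.zmultiples v₀, ?_, ?_, ?_⟩
  · -- `#ℤ v₀ = p`: `v₀ ≠ 0` is killed by `p`
    have hpv₀ : p • v₀ = 0 := by
      rw [← Nat.cast_smul_eq_nsmul (ZMod p), ZMod.natCast_self, zero_smul]
    rw [Nat.card_zmultiples, addOrderOf_eq_prime hpv₀ hv₀]
  · intro σ hσ P
    obtain ⟨b, hb⟩ := hline σ hσ P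
    rw [hb]
    exact hmem b
  · -- an inertia element acting by `-1` on `v₀`
    obtain ⟨τ, hτ, hτv⟩ := exists_mem_inertia_smul_eq_of_sub_mem_line W p hvp h𝔓 hv₀ hline (-1)
    refine ⟨τ, hτ, v₀, AddSubgroup.mem_zmultiples v₀, fun h ↦ hv₀ ?_⟩
    rw [hτv, Units.val_neg, Units.val_one, neg_smul, one_smul] at h
    -- `h : -v₀ = v₀`, so `2 v₀ = 0`, so `v₀ = 0` (`p` odd)
    refine eq_zero_of_add_self_eq_zero hp2 ?_
    nth_rewrite 1 [← h]
    exact neg_add_cancel v₀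

variable (W) in
/-- **(hL) on class X1**: at an anomalous Eisenstein prime `p ≠ 2` of good reduction (`Anom W p`:
`E[p]` reducible, `p ∤ N`, `a_p ≡ 1 (mod p)`, hence ordinary, `goodOrd_of_anom`) Serre's ordinary
line exists at every prime of `\bar ℤ` above `p`, in the `𝔓.inertia` form of `Predicates.lean`.
[cite: SerreInventiones1972, §1.11 Prop. 11 and Cor.] -/
theorem exists_ordinaryLine_of_anom [W.IsGloballyMinimal] (hp2 : p ≠ 2) (h : Anom W p) :
    ∀ (v : HeightOneSpectrum (𝓞 ℚ)), (p : 𝓞 ℚ) ∈ v.asIdeal → ∀ 𝔓 ∈ v.primesAbove,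
      ∃ L : AddSubgroup (geomTorsion W (p : ℤ)), Nat.card L = p ∧
        (∀ σ ∈ 𝔓.inertia (absoluteGaloisGroup ℚ), ∀ P : geomTorsion W (p : ℤ), σ • P - P ∈ L) ∧
        (∃ σ ∈ 𝔓.inertia (absoluteGaloisGroup ℚ), ∃ P ∈ L, σ • P ≠ P) :=
  exists_ordinaryLine_of_not_dvd_frobeniusTrace W hp2 (goodOrd_of_anom W p h).1
    (goodOrd_of_anom W p h).2

/-! ### `GVPar` along isogenies at a good ordinary prime: no residual hypothesis -/

omit [W'.IsElliptic] in
/-- **Transfer of the Greenberg–Vatsal parity type along an isogeny, unconditionally.** Let `E/ℚ`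
be given by a globally minimal `W` with good ORDINARY reduction at the odd prime `p`, and let
`f : E → E'` be a `ℚ`-isogeny with `E[p] ⊄ ker f` (e.g. cyclic). If some rational `p`-isogeny
kernel of `E` is (ramified at `p` ∧ even) ∨ (unramified at `p` ∧ odd), then so is one of `E'`:
`GVPar W p → GVPar W' p`. (`gvPar_of_isogeny_of_ordinaryLine` of gen 2 with its hypothesis (hL)
discharged by `exists_ordinaryLine_of_not_dvd_frobeniusTrace`.) [folklore] -/
theorem gvPar_of_isogeny_of_not_dvd_frobeniusTrace [W.IsGloballyMinimal] (hp2 : p ≠ 2)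
    (hgood : W.HasGoodReductionAtPrime p) (hord : ¬ (p : ℤ) ∣ W.frobeniusTrace p)
    (f : Isogeny W W') (hf : ∃ P : geomPoints W, P ∈ geomTorsion W (p : ℤ) ∧ f P ≠ 0)
    (h : GVPar W p) : GVPar W' p :=
  gvPar_of_isogeny_of_ordinaryLine hp2 (exists_ordinaryLine_of_not_dvd_frobeniusTrace W hp2 hgood hord)
    f hf h

/-- **Isogeny invariance of the Greenberg–Vatsal parity type at a good ordinary odd prime,
unconditionally.** For globally minimal `W`, `W'` over `ℚ`, both with good ordinary reduction at the
odd prime `p`, and `ℚ`-isogenies `f : E → E'`, `f' : E' → E` not killing the `p`-torsion (e.g. a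
cyclic isogeny and its dual): `GVPar W p ↔ GVPar W' p`. [folklore] -/
theorem gvPar_iff_of_isogeny_of_not_dvd_frobeniusTrace [W.IsGloballyMinimal] [W'.IsGloballyMinimal]
    (hp2 : p ≠ 2) (hgood : W.HasGoodReductionAtPrime p) (hord : ¬ (p : ℤ) ∣ W.frobeniusTrace p)
    (hgood' : W'.HasGoodReductionAtPrime p) (hord' : ¬ (p : ℤ) ∣ W'.frobeniusTrace p)
    (f : Isogeny W W') (hf : ∃ P : geomPoints W, P ∈ geomTorsion W (p : ℤ) ∧ f P ≠ 0)
    (f' : Isogeny W' W) (hf' : ∃ P : geomPoints W', P ∈ geomTorsion W' (p : ℤ) ∧ f' P ≠ 0) :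
    GVPar W p ↔ GVPar W' p :=
  gvPar_iff_of_isogeny_of_ordinaryLine hp2
    (exists_ordinaryLine_of_not_dvd_frobeniusTrace W hp2 hgood hord)
    (exists_ordinaryLine_of_not_dvd_frobeniusTrace W' hp2 hgood' hord') f hf f' hf'

/-- **The parity type of class X1 is a property of the isogeny class.** For globally minimal `W`,
`W'` over `ℚ`, an odd prime `p` which is an anomalous Eisenstein prime of good reduction for both
(`Anom W p`, `Anom W' p` — automatic for two members of one isogeny class, which share `N`, `a_p`
and the semisimplification of `E[p]`), and `ℚ`-isogenies `E ⇄ E'` not killing the `p`-torsion: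
`GVPar W p ↔ GVPar W' p`. Hence "type A" (`¬ GVPar`: sub-class X1a at `r_an = 1`, needing Keller–Yin
alone) and "type B" (`GVPar`) of `b2b-bsdres-x1a/X1-CENSUS-g2.md` are well defined on Cremona
classes, as the census found on all 1524 classes `N < 2·10⁴`. [folklore] -/
theorem gvPar_iff_of_isogeny_of_anom [W.IsGloballyMinimal] [W'.IsGloballyMinimal] (hp2 : p ≠ 2)
    (hW : Anom W p) (hW' : Anom W' p)
    (f : Isogeny W W') (hf : ∃ P : geomPoints W, P ∈ geomTorsion W (p : ℤ) ∧ f P ≠ 0)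
    (f' : Isogeny W' W) (hf' : ∃ P : geomPoints W', P ∈ geomTorsion W' (p : ℤ) ∧ f' P ≠ 0) :
    GVPar W p ↔ GVPar W' p :=
  gvPar_iff_of_isogeny_of_not_dvd_frobeniusTrace hp2 (goodOrd_of_anom W p hW).1
    (goodOrd_of_anom W p hW).2 (goodOrd_of_anom W' p hW').1 (goodOrd_of_anom W' p hW').2 f hf f' hf'

end Literature.NumberTheory.EllipticCurves.Rank1Residual

end
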